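import Summits.AnomalousDissipation.AnomalousDissipation.Theses.TaylorCertificates
import Summits.AnomalousDissipation.AnomalousDissipation.Theorems.FloorCertificate.Negative.WeakDuality
import Summits.AnomalousDissipation.AnomalousDissipation.Theorems.FloorCertificate.Negative.Uniform
import Summits.AnomalousDissipation.AnomalousDissipation.Theorems.EnsembleCeiling.Negative.DiracAtoms
import Summits.AnomalousDissipation.AnomalousDissipation.Theorems.EnsembleCeiling.Negative.SingleModeFat
import Summits.AnomalousDissipation.AnomalousDissipation.Theorems.EnsembleCeiling.Negative.CellularFat
import Literature.Analysis.FluidPDE.StatisticalSolutionProofs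
import Summits.AnomalousDissipation.AnomalousDissipation.Theorems.KolmogorovFloorEnsembleCeiling.Negative.Planar

/-!
# Negative knowledge for the crux `KolmogorovFloorEnsembleCeiling` (stmt-AnomalousDissipation-14183), I:
# the same-force squeeze

Crux `TaylorCertificates.KolmogorovFloorEnsembleCeiling` (route `AnomalousDissipation/TaylorCertificates`, rank 7,
cdisprove seat `refuter-cdisprove-stmt-AnomalousDissipation-14183-0`, 2026-08-16): ONE smooth solenoidal mean-zero
force carrying BOTH the Kolmogorov-class floor certificate of crux #2 AND the ensemble ceiling of crux #4. This file
records the kernel-checked necessary conditions of the COUPLING; nothing here asserts a Theses statement.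

* `pair_iff` — the crux unbundled into `PairFor f ε₀ C Θ E ν₀` (definitional).
* `pair_false_of_not_kolmogorovFloor`, `pair_false_of_not_floorCertificate`, `pair_false_of_not_ensembleCeiling` —
  the pair projects onto cruxes #2, #5, #4 for the same force (`f ≠ 0` from the floor at rest,
  `pairFor_force_ne_zero`), so any kill of a sibling kills it.
* THE SQUEEZE: `pairFor_steady` (every steady weak solution `u ∈ V`, `ν < ν₀`, is LOUD `ε₀ ≤ ν‖∇u‖²` AND BOUNDED
  `‖u‖² ≤ E`), `pairFor_statistics` (same for every stationary statistical solution: `ε₀ ≤ ε(μ)`, `e(μ) ≤ E`),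
  `pairFor_window` (`ε₀ ≤ ‖f‖₂ √e(μ) ≤ ‖f‖₂ √E`), `pairFor_constants` (`ε₀² ≤ ‖f‖₂² E`, `0 < E`);
  `exists_steadyState_of_classical` (a smooth classical steady state is an `H`-steady state in `V`) and
  `pair_false_of_not_steadyStatesLoudBounded` — the pair implies route item #3 `SteadyStatesLoudBounded` for the
  SAME force, so "a quiet or a fat steady branch for every force" (open) refutes it; `pair_window` states the
  whole package positively for provers.
* LOAD-BEARING: `pairWithoutFloor_trivial` — with the floor conjunct dropped the statement is true by junk
  (`f = 0`: all stationary statistics of the unforced system sit at rest, `ensembleEnergy_eq_zero_of_zero_force`);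
  `ceilingAt_iff_all` — the integrability hypothesis of the ceiling is decoration; `pairWithoutCeiling_iff` — the
  ceiling dropped is `KolmogorovFloor` on the nose.
* CLASSES EXCLUDED (Marchioro's laminar atoms of the #4 seat, transported): `not_pair_singleMode`,
  `not_pair_singleShell_eulerSteady`, `not_pair_abc`, `not_pair_cellular`; constants: `not_pairFor_of_gap`,
  `not_pairFor_of_nonpos_E`, `not_pair_uniform` (ν-frozen certificates, via #5's `not_floorCertificateUniform`); and ALL
  PLANAR FORCES: `not_pair_planar` (Part II `Negative/Planar.lean`: the 2-D
  steady enstrophy squeeze empties floor ∩ ceiling; the witness force must be genuinely three-dimensional).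
-/

noncomputable section

set_option linter.dupNamespace false

open MeasureTheory UnitAddTorus
open scoped InnerProductSpace ENNReal

namespace Summit.AnomalousDissipation.AnomalousDissipation.Theorems.KolmogorovFloorEnsembleCeiling.Negative

open Literature.Analysis.FunctionSpaces Literature.Analysis.FluidPDE
open Summit.AnomalousDissipation.AnomalousDissipation.Theses.TaylorCertificates
open Summit.AnomalousDissipation.AnomalousDissipation.Theorems.TaylorCertificatePair.Negative
open Summit.AnomalousDissipation.AnomalousDissipation.Theorems.FloorCertificate.Negative
open Summit.AnomalousDissipation.AnomalousDissipation.Theorems.EnsembleCeiling.Negative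

/-! ## (F0) The crux unbundled -/

/-- The Kolmogorov-class FLOOR datum at one viscosity (verbatim the first conjunct of the crux's `∀ ν` body;
identical to `Cruxes/KolmogorovFloor/Disproof.lean :: FloorDataAt (3/4)`). -/
def KFloorAt (f : UnitAddTorus (Fin 3) → EuclideanSpace ℝ (Fin 3)) (ε₀ C Θ ν : ℝ) : Prop :=
  ∃ (N : ℕ) (Φ₁ : Literature.Analysis.FluidPDE.Torus.CylindricalTest (Fin 3)) (θ₁ : ℝ), (N : ℝ) ≤ C * ν ^ (-(3 / 4 : ℝ)) ∧ (∀ i, Literature.Analysis.FunctionSpaces.Torus.fourierTruncate N (Φ₁.g i) = Φ₁.g i) ∧ -Θ ≤ θ₁ ∧ θ₁ ≤ 0 ∧ ∀ u : Literature.Analysis.FunctionSpaces.Torus.energySpace (Fin 3), let uf : UnitAddTorus (Fin 3) → EuclideanSpace ℝ (Fin 3) := ((u : MeasureTheory.Lp (EuclideanSpace ℝ (Fin 3)) 2 (MeasureTheory.volume : MeasureTheory.Measure (UnitAddTorus (Fin 3)))) : UnitAddTorus (Fin 3) → EuclideanSpace ℝ (Fin 3)); let D : ℝ := ν * (Literature.Analysis.FunctionSpaces.Torus.eGradNormSq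 uf).toReal; let P : ℝ := Literature.Analysis.FluidPDE.Torus.pairing (u : MeasureTheory.Lp (EuclideanSpace ℝ (Fin 3)) 2 (MeasureTheory.volume : MeasureTheory.Measure (UnitAddTorus (Fin 3)))) f - D; Literature.Analysis.FunctionSpaces.Torus.eGradNormSq uf ≠ ⊤ → ‖u‖ ^ 2 ≤ 16 * (∫ x, ‖f x‖ ^ 2) / ν ^ 2 → ε₀ ≤ D + Literature.Analysis.FluidPDE.Torus.nsGeneratorPairing ν f u (Φ₁.grad u) + 2 * θ₁ * P

/-- The ENSEMBLE CEILING at one viscosity (verbatim the second conjunct of the crux's `∀ ν` body, and the inner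
block of `EnsembleCeiling`). -/
def CeilingAt (f : UnitAddTorus (Fin 3) → EuclideanSpace ℝ (Fin 3)) (E ν : ℝ) : Prop :=
  ∀ μ : MeasureTheory.Measure (Literature.Analysis.FunctionSpaces.Torus.energySpace (Fin 3)), Literature.Analysis.FluidPDE.Torus.IsStationaryStatisticalSolution ν f μ → MeasureTheory.Integrable (fun v : Literature.Analysis.FunctionSpaces.Torus.energySpace (Fin 3) => ‖v‖ ^ 2) μ → Literature.Analysis.FluidPDE.Torus.ensembleEnergy μ ≤ E

/-- The pair FOR the force `f` with constants `ε₀, C, Θ, E, ν₀`. -/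
def PairFor (f : UnitAddTorus (Fin 3) → EuclideanSpace ℝ (Fin 3)) (ε₀ C Θ E ν₀ : ℝ) : Prop :=
  0 < ε₀ ∧ 0 < ν₀ ∧ ∀ ν : ℝ, 0 < ν → ν < ν₀ → KFloorAt f ε₀ C Θ ν ∧ CeilingAt f E ν

/-- (F0) The crux IS `∃ f admissible, ∃ constants, PairFor f …`, definitionally. -/
theorem pair_iff : KolmogorovFloorEnsembleCeiling ↔
    ∃ f : UnitAddTorus (Fin 3) → EuclideanSpace ℝ (Fin 3), Torus.IsSmooth f ∧ Torus.IsDivFree f ∧ Torus.HasZeroMean f ∧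
      ∃ (ε₀ C Θ E ν₀ : ℝ), PairFor f ε₀ C Θ E ν₀ :=
  Iff.rfl

/-! ## (F1) Projections onto the sibling cruxes -/

/-- A Kolmogorov-class floor datum is in particular a floor family in the sense of
`Theorems/FloorCertificate/Negative/WeakDuality.lean` (forget `N`, the band limit and the weight floor). -/
theorem kFloorAt_floorFamily {f : UnitAddTorus (Fin 3) → EuclideanSpace ℝ (Fin 3)} {ε₀ C Θ ν : ℝ}
    (h : KFloorAt f ε₀ C Θ ν) : FloorFamily f ε₀ ν := by
  obtain ⟨N, Φ₁, θ₁, -, -, -, hθ₁, hu⟩ := h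
  exact ⟨Φ₁, θ₁, hθ₁, hu⟩

/-- (F0/F1) The force of a witness is not (a.e.) zero — the floor at rest (`ε₀ ≤ (f, Φ₁'(0))`) excludes it, so
the `0 < ∫‖f‖²` clause that `EnsembleCeiling` carries explicitly is automatic here. -/
theorem pairFor_force_ne_zero {f : UnitAddTorus (Fin 3) → EuclideanSpace ℝ (Fin 3)} (hf : Torus.IsSmooth f)
    {ε₀ C Θ E ν₀ : ℝ} (h : PairFor f ε₀ C Θ E ν₀) : 0 < ∫ x, ‖f x‖ ^ 2 :=
  floorFamily_force_ne_zero hf h.1 (half_pos h.2.1)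
    (kFloorAt_floorFamily (h.2.2 _ (half_pos h.2.1) (half_lt_self h.2.1)).1)

/-- (F1) A kill of `KolmogorovFloor` (#2) kills the pair: the pair projects onto #2 for the same force. -/
theorem pair_false_of_not_kolmogorovFloor (h : ¬ KolmogorovFloor) : ¬ KolmogorovFloorEnsembleCeiling := by
  rintro ⟨f, hfs, hfd, hfz, ε₀, C, Θ, E, ν₀, hε₀, hν₀, hall⟩
  exact h ⟨f, hfs, hfd, hfz, ε₀, C, Θ, ν₀, hε₀, hν₀, fun ν hν hνν₀ => (hall ν hν hνν₀).1⟩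

/-- (F1) A kill of `FloorCertificate` (#5) kills the pair (forget `N`, the band limit and the weight floor). -/
theorem pair_false_of_not_floorCertificate (h : ¬ FloorCertificate) : ¬ KolmogorovFloorEnsembleCeiling := by
  rintro ⟨f, hfs, hfd, hfz, ε₀, C, Θ, E, ν₀, hε₀, hν₀, hall⟩
  refine h ⟨f, hfs, hfd, hfz, ε₀, ν₀, hε₀, hν₀, fun ν hν hνν₀ => ?_⟩
  obtain ⟨⟨N, Φ₁, θ₁, -, -, -, hθ₁, hu⟩, -⟩ := hall ν hν hνν₀
  exact ⟨Φ₁, θ₁, hθ₁, hu⟩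

/-- (F1) A kill of `EnsembleCeiling` (#4) kills the pair (`f ≠ 0` supplied by the floor at rest). -/
theorem pair_false_of_not_ensembleCeiling (h : ¬ EnsembleCeiling) : ¬ KolmogorovFloorEnsembleCeiling := by
  intro hp
  obtain ⟨f, hfs, hfd, hfz, ε₀, C, Θ, E, ν₀, hP⟩ := pair_iff.1 hp
  exact h ⟨f, hfs, hfd, hfz, pairFor_force_ne_zero hfs hP, E, ν₀, hP.2.1, fun ν hν hνν₀ => (hP.2.2 ν hν hνν₀).2⟩

/-! ## (F2) The same-force squeeze -/

/-- (F2) **Steady states of a witness force are loud AND bounded.** For every `ν ∈ (0, ν₀)` and every steady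
weak solution `u ∈ V` of `NS_ν(f)`: `ε₀ ≤ ν‖∇u‖²` (floor, Dirac case of weak duality) and `‖u‖² ≤ E`
(ceiling at the Dirac mass `δ_u`, a stationary statistical solution). -/
theorem pairFor_steady {f : UnitAddTorus (Fin 3) → EuclideanSpace ℝ (Fin 3)} (hf : Torus.IsSmooth f)
    {ε₀ C Θ E ν₀ : ℝ} (h : PairFor f ε₀ C Θ E ν₀) {ν : ℝ} (hν : 0 < ν) (hνν₀ : ν < ν₀)
    {u : Torus.energySpace (Fin 3)}
    (hV : (u : Lp (EuclideanSpace ℝ (Fin 3)) 2 (volume : Measure (UnitAddTorus (Fin 3)))) ∈ Torus.energySpaceV (Fin 3))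
    (hu : Torus.IsSteadyWeakSolution ν f u) :
    ε₀ ≤ ν * (Torus.eGradNormSq ((u : Lp (EuclideanSpace ℝ (Fin 3)) 2 (volume : Measure (UnitAddTorus (Fin 3)))) : UnitAddTorus (Fin 3) → EuclideanSpace ℝ (Fin 3))).toReal ∧
      ‖u‖ ^ 2 ≤ E := by
  have hf2 : MemLp f 2 volume := hf.memLp 2
  obtain ⟨hfl, hceil⟩ := h.2.2 ν hν hνν₀
  exact ⟨floorFamily_le_dissipation_of_steady hν hf2 (kFloorAt_floorFamily hfl) hV hu,
    norm_sq_le_of_ceiling hν hf2 hceil hV hu⟩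

/-- (F2) **Stationary statistics of a witness force are loud AND bounded**: `ε₀ ≤ ε(μ)` (weak duality,
`floorFamily_le_ensembleDissipation`) and `e(μ) ≤ E` (the ceiling; integrability of the energy is automatic). -/
theorem pairFor_statistics {f : UnitAddTorus (Fin 3) → EuclideanSpace ℝ (Fin 3)} (hf : Torus.IsSmooth f)
    {ε₀ C Θ E ν₀ : ℝ} (h : PairFor f ε₀ C Θ E ν₀) {ν : ℝ} (hν : 0 < ν) (hνν₀ : ν < ν₀)
    {μ : Measure (Torus.energySpace (Fin 3))} (hμ : Torus.IsStationaryStatisticalSolution ν f μ) :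
    ε₀ ≤ Torus.ensembleDissipation ν μ ∧ Torus.ensembleEnergy μ ≤ E := by
  have hf2 : MemLp f 2 volume := hf.memLp 2
  obtain ⟨hfl, hceil⟩ := h.2.2 ν hν hνν₀
  exact ⟨floorFamily_le_ensembleDissipation hν hf2 (kFloorAt_floorFamily hfl) hμ, hceil μ hμ hμ.integrable_norm_sq⟩

/-- (F2) **The window.** For a witness and any stationary statistical solution at `ν < ν₀`:
`ε₀ ≤ ε(μ) ≤ ‖f‖₂ √e(μ)` (FMRT IV (1.31)–(1.34)), whence `ε₀ ≤ ‖f‖₂ √E`. -/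
theorem pairFor_window {f : UnitAddTorus (Fin 3) → EuclideanSpace ℝ (Fin 3)} (hf : Torus.IsSmooth f)
    {ε₀ C Θ E ν₀ : ℝ} (h : PairFor f ε₀ C Θ E ν₀) {ν : ℝ} (hν : 0 < ν) (hνν₀ : ν < ν₀)
    {μ : Measure (Torus.energySpace (Fin 3))} (hμ : Torus.IsStationaryStatisticalSolution ν f μ) :
    ε₀ ≤ Real.sqrt (∫ x, ‖f x‖ ^ 2) * Real.sqrt (Torus.ensembleEnergy μ) ∧
      ε₀ ≤ Real.sqrt (∫ x, ‖f x‖ ^ 2) * Real.sqrt E := by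
  have hf2 : MemLp f 2 volume := hf.memLp 2
  obtain ⟨hloud, hbdd⟩ := pairFor_statistics hf h hν hνν₀ hμ
  have h1 : ε₀ ≤ Real.sqrt (∫ x, ‖f x‖ ^ 2) * Real.sqrt (Torus.ensembleEnergy μ) :=
    hloud.trans (Torus.ensembleDissipation_le_of_isStationary_holds hμ hf2 hμ.integrable_norm_sq)
  exact ⟨h1, h1.trans (mul_le_mul_of_nonneg_left (Real.sqrt_le_sqrt hbdd) (Real.sqrt_nonneg _))⟩

/-- (F2) **Constants of a witness**: `ε₀² ≤ ‖f‖₂² · E` and `0 < E` (a steady state exists at `ν = ν₀/2`,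
Temam 1979 Thm 1.2, PROVED in tree; it is loud and bounded, and `ν‖∇u‖² = (u,f) ≤ ‖u‖‖f‖₂`). -/
theorem pairFor_constants {f : UnitAddTorus (Fin 3) → EuclideanSpace ℝ (Fin 3)} (hf : Torus.IsSmooth f)
    {ε₀ C Θ E ν₀ : ℝ} (h : PairFor f ε₀ C Θ E ν₀) : ε₀ ^ 2 ≤ (∫ x, ‖f x‖ ^ 2) * E ∧ 0 < E := by
  have hf2 : MemLp f 2 volume := hf.memLp 2
  have hν : 0 < ν₀ / 2 := half_pos h.2.1
  obtain ⟨u, hV, hu⟩ := Torus.Temam1979_exists_steadyWeakSolution_holds (by simp) hν hf2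
  obtain ⟨hloud, hbdd⟩ := pairFor_steady hf h hν (half_lt_self h.2.1) hV hu
  have henergy := Torus.IsSteadyWeakSolution.energy_eq' (by simp) hf2 hV hu
  have hp : Torus.pairing (u : Lp (EuclideanSpace ℝ (Fin 3)) 2 (volume : Measure (UnitAddTorus (Fin 3)))) f ≤ ‖u‖ * ‖hf2.toLp f‖ :=
    (le_abs_self _).trans (Torus.abs_pairing_coe_le hf2 u)
  have h1 : ε₀ ≤ ‖u‖ * ‖hf2.toLp f‖ := by rw [henergy] at hloud; exact hloud.trans hp
  have h2 : ε₀ ^ 2 ≤ (‖u‖ * ‖hf2.toLp f‖) ^ 2 := pow_le_pow_left₀ h.1.le h1 2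
  rw [mul_pow, norm_toLp_sq hf2] at h2
  have hF : 0 ≤ ∫ x, ‖f x‖ ^ 2 := integral_nonneg fun x => by positivity
  refine ⟨?_, ?_⟩
  · calc ε₀ ^ 2 ≤ ‖u‖ ^ 2 * ∫ x, ‖f x‖ ^ 2 := h2
      _ ≤ E * ∫ x, ‖f x‖ ^ 2 := mul_le_mul_of_nonneg_right hbdd hF
      _ = (∫ x, ‖f x‖ ^ 2) * E := mul_comm _ _
  · by_contra hE
    have hE' : E ≤ 0 := le_of_not_gt hE
    have hu0 : ‖u‖ ^ 2 = 0 := le_antisymm (hbdd.trans hE') (sq_nonneg _)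
    rw [hu0, zero_mul] at h2
    nlinarith [h.1]

/-- (F2) **`¬SteadyStatesLoudBounded` kills the pair**: the pair implies route item #3 FOR THE SAME FORCE (the
planner's "cheapest necessary condition of X at the steady states", an honest implication now that the force is
shared) — every smooth classical steady state `u` of `NS_ν(f)`, `ν < ν₀`, has `ε₀ ≤ ν‖∇u‖²` and `∫‖u‖² ≤ E`. So a
quiet OR a fat smooth steady state at arbitrarily small viscosity FOR EVERY FORCE (open) refutes the crux. Plain
negative lemma (no hold requested: the hypothesis is an open dynamical statement, not a construction). -/
theorem pair_false_of_not_steadyStatesLoudBounded (h : ¬ SteadyStatesLoudBounded) :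
    ¬ KolmogorovFloorEnsembleCeiling := by
  intro hp
  obtain ⟨f, hfs, hfd, hfz, ε₀, C, Θ, E, ν₀, hP⟩ := pair_iff.1 hp
  refine h ⟨f, hfs, hfd, hfz, ε₀, E, ν₀, hP.1, hP.2.1, fun ν hν hνν₀ u hu hdiv hmean hsteady => ?_⟩
  obtain ⟨U, hU, hV, hUsteady⟩ := exists_steadyState_of_classical hfs hu hdiv hmean hsteady
  obtain ⟨hloud, hbdd⟩ := pairFor_steady hfs hP hν hνν₀ hV hUsteady
  rw [eGradNormSq_congr_ae' hU, ← Torus.gradNormSq_eq_toReal_eGradNormSq_holds hu] at hloud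
  rw [norm_sq_of_ae hU] at hbdd
  exact ⟨hloud, hbdd⟩

/-- (F2) **What the crux buys, stated positively for the provers**: under the pair, the witness force is non-zero,
its constants satisfy `ε₀² ≤ ‖f‖₂² E`, `0 < E`, and for every `ν < ν₀` Leray's steady states (which exist at every
`ν`) and all stationary statistical solutions live in the window `{ε ≥ ε₀} ∩ {e ≤ E}`. A prover must control BOTH
sides of EVERY small-viscosity steady state of the chosen `f` before any certificate is written. -/
theorem pair_window (h : KolmogorovFloorEnsembleCeiling) :
    ∃ f : UnitAddTorus (Fin 3) → EuclideanSpace ℝ (Fin 3), Torus.IsSmooth f ∧ 0 < ∫ x, ‖f x‖ ^ 2 ∧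
      ∃ ε₀ E ν₀ : ℝ, 0 < ε₀ ∧ 0 < E ∧ 0 < ν₀ ∧ ε₀ ^ 2 ≤ (∫ x, ‖f x‖ ^ 2) * E ∧
      ∀ ν : ℝ, 0 < ν → ν < ν₀ →
        (∃ u : Torus.energySpace (Fin 3), (u : Lp (EuclideanSpace ℝ (Fin 3)) 2 (volume : Measure (UnitAddTorus (Fin 3)))) ∈ Torus.energySpaceV (Fin 3) ∧
          Torus.IsSteadyWeakSolution ν f u) ∧
        (∀ u : Torus.energySpace (Fin 3), (u : Lp (EuclideanSpace ℝ (Fin 3)) 2 (volume : Measure (UnitAddTorus (Fin 3)))) ∈ Torus.energySpaceV (Fin 3) →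
          Torus.IsSteadyWeakSolution ν f u →
            ε₀ ≤ ν * (Torus.eGradNormSq ((u : Lp (EuclideanSpace ℝ (Fin 3)) 2 (volume : Measure (UnitAddTorus (Fin 3)))) : UnitAddTorus (Fin 3) → EuclideanSpace ℝ (Fin 3))).toReal ∧
              ‖u‖ ^ 2 ≤ E) ∧
        (∀ μ : Measure (Torus.energySpace (Fin 3)), Torus.IsStationaryStatisticalSolution ν f μ →
          ε₀ ≤ Torus.ensembleDissipation ν μ ∧ Torus.ensembleEnergy μ ≤ E) := by
  obtain ⟨f, hfs, hfd, hfz, ε₀, C, Θ, E, ν₀, hP⟩ := pair_iff.1 h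
  have hf2 : MemLp f 2 volume := hfs.memLp 2
  obtain ⟨hwin, hE⟩ := pairFor_constants hfs hP
  refine ⟨f, hfs, pairFor_force_ne_zero hfs hP, ε₀, E, ν₀, hP.1, hE, hP.2.1, hwin, fun ν hν hνν₀ => ⟨?_, ?_, ?_⟩⟩
  · exact Torus.Temam1979_exists_steadyWeakSolution_holds (by simp) hν hf2
  · exact fun u hV hu => pairFor_steady hfs hP hν hνν₀ hV hu
  · exact fun μ hμ => pairFor_statistics hfs hP hν hνν₀ hμ

/-! ## (F3) Load-bearing hypotheses -/

/-- The crux with the FLOOR conjunct dropped (everything else verbatim). -/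
def PairWithoutFloor : Prop :=
  ∃ f : UnitAddTorus (Fin 3) → EuclideanSpace ℝ (Fin 3), Torus.IsSmooth f ∧ Torus.IsDivFree f ∧ Torus.HasZeroMean f ∧
    ∃ (E ν₀ : ℝ), 0 < ν₀ ∧ ∀ ν : ℝ, 0 < ν → ν < ν₀ → CeilingAt f E ν

/-- Every stationary statistical solution of the UNFORCED system at `ν > 0` sits at rest: its mean energy is
`0` (FMRT's support bound (1.34) with `‖f‖₂ = 0`). -/
theorem ensembleEnergy_eq_zero_of_zero_force {ν : ℝ} (hν : 0 < ν) {μ : Measure (Torus.energySpace (Fin 3))}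
    (hμ : Torus.IsStationaryStatisticalSolution ν (0 : UnitAddTorus (Fin 3) → EuclideanSpace ℝ (Fin 3)) μ) :
    Torus.ensembleEnergy μ = 0 := by
  have hf : MemLp (0 : UnitAddTorus (Fin 3) → EuclideanSpace ℝ (Fin 3)) 2 volume :=
    (Torus.isSmooth_const (0 : EuclideanSpace ℝ (Fin 3))).memLp 2
  have h0 : ‖hf.toLp (0 : UnitAddTorus (Fin 3) → EuclideanSpace ℝ (Fin 3))‖ = 0 := by
    have := norm_toLp_sq hf
    simp only [Pi.zero_apply, norm_zero, ne_eq, OfNat.ofNat_ne_zero, not_false_eq_true, zero_pow,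
      integral_zero] at this
    exact pow_eq_zero_iff (n := 2) (by norm_num) |>.1 this
  have hae : ∀ᵐ u ∂μ, ‖u‖ ^ 2 = 0 := by
    filter_upwards [hμ.ae_norm_le hν hf] with u hu
    rw [h0, zero_div] at hu
    have : ‖u‖ = 0 := le_antisymm hu (norm_nonneg _)
    rw [this]; ring
  unfold Torus.ensembleEnergy
  rw [integral_congr_ae hae, integral_zero]

/-- (F3a) **The floor conjunct is load-bearing in the trivial sense**: with it dropped, the statement is TRUE
by junk — the vanishing force, whose stationary statistics all sit at rest. (So, as for #4, any honest
ceiling statement needs `f ≠ 0`; here the floor supplies it, `pairFor_force_ne_zero`.) -/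
theorem pairWithoutFloor_trivial : PairWithoutFloor := by
  refine ⟨0, ?_, ?_, ?_, 0, 1, one_pos, fun ν hν _ μ hμ _ => (ensembleEnergy_eq_zero_of_zero_force hν hμ).le⟩
  · exact Torus.isSmooth_const (0 : EuclideanSpace ℝ (Fin 3))
  · intro x
    simp [Torus.divergence, Torus.partialDeriv, Torus.lineDeriv]
  · simp [Torus.HasZeroMean]

/-- (F3b) The crux with the CEILING conjunct dropped is `KolmogorovFloor` (#2) on the nose. -/
theorem pairWithoutCeiling_iff :
    (∃ f : UnitAddTorus (Fin 3) → EuclideanSpace ℝ (Fin 3), Torus.IsSmooth f ∧ Torus.IsDivFree f ∧ Torus.HasZeroMean f ∧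
      ∃ (ε₀ C Θ ν₀ : ℝ), 0 < ε₀ ∧ 0 < ν₀ ∧ ∀ ν : ℝ, 0 < ν → ν < ν₀ → KFloorAt f ε₀ C Θ ν) ↔ KolmogorovFloor :=
  Iff.rfl

/-- (F3c) **The integrability hypothesis of the ceiling is decoration**: every stationary statistical solution
has integrable energy (FMRT (1.29) + Poincaré, tree lemma `integrable_norm_sq`). Provers may drop it. -/
theorem ceilingAt_iff_all {f : UnitAddTorus (Fin 3) → EuclideanSpace ℝ (Fin 3)} {E ν : ℝ} :
    CeilingAt f E ν ↔ ∀ μ : Measure (Torus.energySpace (Fin 3)),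
      Torus.IsStationaryStatisticalSolution ν f μ → Torus.ensembleEnergy μ ≤ E :=
  ⟨fun h μ hμ => h μ hμ hμ.integrable_norm_sq, fun h μ hμ _ => h μ hμ⟩

/-! ## (F4) Natural strengthenings and force classes refuted -/

/-- (F4) No witness has `‖f‖₂² E < ε₀²` (the window of (F2)). -/
theorem not_pairFor_of_gap {f : UnitAddTorus (Fin 3) → EuclideanSpace ℝ (Fin 3)} (hf : Torus.IsSmooth f)
    {ε₀ C Θ E ν₀ : ℝ} (hgap : (∫ x, ‖f x‖ ^ 2) * E < ε₀ ^ 2) : ¬ PairFor f ε₀ C Θ E ν₀ :=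
  fun h => absurd (pairFor_constants hf h).1 (not_le.2 hgap)

/-- (F4) No witness has `E ≤ 0`. -/
theorem not_pairFor_of_nonpos_E {f : UnitAddTorus (Fin 3) → EuclideanSpace ℝ (Fin 3)} (hf : Torus.IsSmooth f)
    {ε₀ C Θ E ν₀ : ℝ} (hE : E ≤ 0) : ¬ PairFor f ε₀ C Θ E ν₀ :=
  fun h => absurd (pairFor_constants hf h).2 (not_lt.2 hE)

/-- (F4) **No single-mode witness** (`f = Re(e_k z)`, `k ≠ 0`, `k·z = 0`, `z ≠ 0`): Marchioro's laminar Dirac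
mass has mean energy `‖f‖₂²/(16π⁴|k|⁴ν²)` (`not_ceiling_of_singleMode`, #4 seat). -/
theorem not_pair_singleMode {k : Fin 3 → ℤ} {z : EuclideanSpace ℂ (Fin 3)} (hk : k ≠ 0)
    (hz : ((fun j => ((k j : ℤ) : ℂ)) ⬝ᵥ (WithLp.ofLp z)) = 0) (hz0 : z ≠ 0) :
    ¬ ∃ (ε₀ C Θ E ν₀ : ℝ), PairFor (Torus.realTrigPoly {k} (fun _ => z)) ε₀ C Θ E ν₀ := by
  rintro ⟨ε₀, C, Θ, E, ν₀, h⟩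
  exact not_ceiling_of_singleMode hk hz hz0 ⟨E, ν₀, h.2.1, fun ν hν hνν₀ => (h.2.2 ν hν hνν₀).2⟩

/-- (F4) **No single-shell Euler-steady witness** (`f = ∑ₘ Re(e_{kₘ} zₘ)` transversal on one shell
`|kₘ|² = s`, with `∫ (f ⊗ f) : ∇w = 0` for all test fields — shear, Beltrami/ABC, cellular, any steady Euler
profile on one Stokes shell): the laminar Dirac mass `f/(4π²sν)` has mean energy `‖f‖₂²/(16π⁴s²ν²)`
(`not_ceiling_of_singleShell_eulerSteady`, #4 seat); `f ≠ 0` comes from the floor at rest. This is the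
Marchioro barrier (`Literature.Barriers.AnomalousDissipation.Marchioro1986_globalAttraction`) biting the pair. -/
theorem not_pair_singleShell_eulerSteady {n : ℕ} {k : Fin n → (Fin 3 → ℤ)} {z : Fin n → EuclideanSpace ℂ (Fin 3)}
    {s : ℝ} (hs : ∀ m, Torus.freqNormSq (k m) = s) (hs0 : 0 < s)
    (hz : ∀ m, ((fun j => ((k m j : ℤ) : ℂ)) ⬝ᵥ (WithLp.ofLp (z m))) = 0)
    (hI : ∀ w : UnitAddTorus (Fin 3) → EuclideanSpace ℝ (Fin 3), Torus.IsSmooth w → Torus.IsDivFree w →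
      Torus.HasZeroMean w →
        ∫ x, ⟪Torus.fderiv w x ((∑ mm, Torus.realTrigPoly {k mm} (fun _ => z mm)) x),
          (∑ mm, Torus.realTrigPoly {k mm} (fun _ => z mm)) x⟫_ℝ = 0) :
    ¬ ∃ (ε₀ C Θ E ν₀ : ℝ), PairFor (∑ mm, Torus.realTrigPoly {k mm} (fun _ => z mm)) ε₀ C Θ E ν₀ := by
  rintro ⟨ε₀, C, Θ, E, ν₀, h⟩
  exact not_ceiling_of_singleShell_eulerSteady hs hs0 hz hI (pairFor_force_ne_zero (isSmooth_modes k z) h)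
    ⟨E, ν₀, h.2.1, fun ν hν hνν₀ => (h.2.2 ν hν hνν₀).2⟩

/-- (F4) **No ABC witness** (`(A,B,C) ≠ 0`; pure-helical first-shell forces). -/
theorem not_pair_abc {A B C : ℝ} (hABC : A ≠ 0 ∨ B ≠ 0 ∨ C ≠ 0) :
    ¬ ∃ (ε₀ C' Θ E ν₀ : ℝ), PairFor
      (∑ mm, Torus.realTrigPoly {(![![0, 0, 1], ![1, 0, 0], ![0, 1, 0]] : Fin 3 → (Fin 3 → ℤ)) mm}
        (fun _ => (![(A : ℂ) • (WithLp.toLp 2 ![-Complex.I, 1, 0] : EuclideanSpace ℂ (Fin 3)),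
                    (B : ℂ) • (WithLp.toLp 2 ![0, -Complex.I, 1] : EuclideanSpace ℂ (Fin 3)),
                    (C : ℂ) • (WithLp.toLp 2 ![1, 0, -Complex.I] : EuclideanSpace ℂ (Fin 3))] : Fin 3 → EuclideanSpace ℂ (Fin 3)) mm))
      ε₀ C' Θ E ν₀ := by
  rintro ⟨ε₀, C', Θ, E, ν₀, h⟩
  exact not_ceiling_abc hABC ⟨E, ν₀, h.2.1, fun ν hν hνν₀ => (h.2.2 ν hν hνν₀).2⟩

/-- (F4) **No planar cellular witness** (`(P,Q) ≠ 0`; Taylor–Green / four-roll-mill force included). -/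
theorem not_pair_cellular {P Q : ℂ} (hPQ : P ≠ 0 ∨ Q ≠ 0) :
    ¬ ∃ (ε₀ C Θ E ν₀ : ℝ), PairFor
      (∑ mm, Torus.realTrigPoly {(![![1, 1, 0], ![1, -1, 0]] : Fin 2 → (Fin 3 → ℤ)) mm}
          (fun _ => (![P • (WithLp.toLp 2 ![1, -1, 0] : EuclideanSpace ℂ (Fin 3)),
                      Q • (WithLp.toLp 2 ![1, 1, 0] : EuclideanSpace ℂ (Fin 3))] : Fin 2 → EuclideanSpace ℂ (Fin 3)) mm))
      ε₀ C Θ E ν₀ := by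
  rintro ⟨ε₀, C, Θ, E, ν₀, h⟩
  exact not_ceiling_cellular hPQ ⟨E, ν₀, h.2.1, fun ν hν hνν₀ => (h.2.2 ν hν hνν₀).2⟩

/-- (F4) **The ν-UNIFORM strengthening of the pair is false for every force** (quantifier swap: one band-limited
`Φ₁` and one weight `θ₁` chosen before `ν` and serving every `ν < ν₀`): project onto the #5 seat's
`not_floorCertificateUniform` (`Theorems/FloorCertificate/Negative/Uniform.lean`: escaping plane waves beating at a
mode of the frozen multiplier). So any witness of the pair must let its certificate sharpen as `ν → 0` — within the
allowed resolution `N ≤ Cν^{-3/4}` and weight window `[-Θ, 0]`. -/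
theorem not_pair_uniform :
    ¬ ∃ f : UnitAddTorus (Fin 3) → EuclideanSpace ℝ (Fin 3), Torus.IsSmooth f ∧ Torus.IsDivFree f ∧ Torus.HasZeroMean f ∧
      ∃ (ε₀ C Θ E ν₀ : ℝ) (N : ℕ) (Φ₁ : Torus.CylindricalTest (Fin 3)) (θ₁ : ℝ), 0 < ε₀ ∧ 0 < ν₀ ∧
        (∀ i, Torus.fourierTruncate N (Φ₁.g i) = Φ₁.g i) ∧ -Θ ≤ θ₁ ∧ θ₁ ≤ 0 ∧
        ∀ ν : ℝ, 0 < ν → ν < ν₀ →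
          ((N : ℝ) ≤ C * ν ^ (-(3 / 4 : ℝ)) ∧ ∀ u : Torus.energySpace (Fin 3), FloorIneq ν f Φ₁ θ₁ ε₀ u) ∧ CeilingAt f E ν := by
  rintro ⟨f, hfs, hfd, hfz, ε₀, C, Θ, E, ν₀, N, Φ₁, θ₁, hε₀, hν₀, -, -, hθ₁, h⟩
  exact not_floorCertificateUniform ⟨f, hfs, hfd, hfz, ε₀, ν₀, Φ₁, θ₁, hε₀, hν₀, hθ₁,
    fun ν hν hνν₀ => (h ν hν hνν₀).1.2⟩

/-- (F4/F5) **Pair ⇒ #3-body at every viscosity, same force** (re-export of Part II's bridge through `PairFor`). -/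
theorem loudBoundedSteadyAt_of_pairFor {f : UnitAddTorus (Fin 3) → EuclideanSpace ℝ (Fin 3)} (hf : Torus.IsSmooth f)
    {ε₀ C Θ E ν₀ : ℝ} (h : PairFor f ε₀ C Θ E ν₀) {ν : ℝ} (hν : 0 < ν) (hνν₀ : ν < ν₀) :
    LoudBoundedSteadyAt f ε₀ E ν :=
  loudBoundedSteadyAt_of_floor_ceiling hf hν (kFloorAt_floorFamily (h.2.2 ν hν hνν₀).1) (h.2.2 ν hν hνν₀).2

/-- (F5) **NO PLANAR WITNESS OF THE PAIR**: for `f = (g₁, g₂, 0)(x₁, x₂)` (`g` smooth mean-zero on `T²`) no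
constants `ε₀, C, Θ, E, ν₀` carry the pair (Part II, `not_loudBounded_planar`: the 2-D steady enstrophy squeeze
empties floor ∩ ceiling on planar forces). The witness force of crux #7 — like that of the target `X` — must be
genuinely three-dimensional. -/
theorem not_pair_planar {g : UnitAddTorus (Fin 2) → EuclideanSpace ℝ (Fin 2)} (hg : Torus.IsSmooth g)
    (hgm : Torus.HasZeroMean g) :
    ¬ ∃ (ε₀ C Θ E ν₀ : ℝ), PairFor (planarLift g) ε₀ C Θ E ν₀ := by
  rintro ⟨ε₀, C, Θ, E, ν₀, h⟩
  exact not_loudBounded_planar hg hgm h.1 h.2.1 fun ν hν hνν₀ =>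
    loudBoundedSteadyAt_of_pairFor (isSmooth_planarLift hg) h hν hνν₀

end Summit.AnomalousDissipation.AnomalousDissipation.Theorems.KolmogorovFloorEnsembleCeiling.Negative
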